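import Summits.BirchSwinnertonDyer.BirchSwinnertonDyer.Theorems.ByReductionTypeAtTwoOrdKatoOptimalLedger
import Summits.BirchSwinnertonDyer.Rank1Residual.X10.CoreTheoremAOddPrime
import Summits.BirchSwinnertonDyer.Rank1Residual.X5.KatoOrdTwoMuPart
import Summits.BirchSwinnertonDyer.Rank1Residual.X5.TwoAdicImageCriteriaLift
import Literature.NumberTheory.EllipticCurves.Kato2004.EulerSystemBoundFineSelmerTwo
import Literature.NumberTheory.EllipticCurves.TwoAdicImageGoodOrdinaryAtTwoProofs
import Literature.NumberTheory.EllipticCurves.NonEisensteinPrimeOfSurjective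
import HarnessLib

/-!
# Sketch for crux idea `sign-blind-kolyvagin-primes` (crux `ByReductionTypeAtTwo.OrdKatoHalfAtTwoIso`,
# item stmt-BirchSwinnertonDyer-19573; crux-ideate ideator 2/2, gen 7).  BSD is not proved; the crux is
# not proved; nothing is booked.  Contents:
# §1 the LOCAL LEVER as a theorem of linear algebra (sorry-free): over a ring of characteristic 2, the
#    operator `N = Frob_q − 1` on `E[2] ⊗ Ω_J` at a prime `q` with `ρ̄(Frob_q)` a transposition and
#    cyclotomic image `γ_q = 1 + s`, `s² = 0`, written in the basis (τ-fixed vector, other vector) is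
#    `N(x,y) = (s x + u y, s y)` with `u` a unit; we prove `N ∘ N = 0` and `ker N = range N = {(u y, s y)}`
#    — i.e. `H¹_f(ℚ_q, 𝒯̄_J) = coker N` and `H¹_s = ker N` are free of rank ONE over `Ω_J` and the
#    finite–singular comparison `φ^{fs} = (mult. by N)` is an isomorphism (Mazur–Rubin's Kolyvagin-prime
#    condition, rank one, in characteristic 2 — no `q ≡ 1 (mod 4)` needed).
# §2 the sign-blind depth count (decidable sanity instances).
# §3 the typed OUTPUT of the line = L1's SOCKET 1 (`CoreTheoremATwoResidue`) re-spelled with the tree's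
#    `p = 2` Euler-system predicate `Kato2004.IsEulerSystemClassTwo` (the `p`-generic `IsEulerSystemClass`
#    is empty of Kato's classes at `2`: `ℚ₁ = ℚ(√2) ⊄ ℚ(μ₄)`, file `Kato2004/EulerSystemBoundFineSelmerTwo`).
-/

noncomputable section

open scoped Classical MatrixGroups ModularForm NumberField
open CongruenceSubgroup WeierstrassCurve Field IsDedekindDomain
open Literature.NumberTheory.GaloisRepresentations
open Literature.NumberTheory.EllipticCurves Literature.NumberTheory.EllipticCurves.ModularForms
open Literature.NumberTheory.EllipticCurves.Kato2004
  Literature.NumberTheory.EllipticCurves.Kato2004.EulerSystemValues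
open Literature.NumberTheory.EllipticCurves.Rank1Residual
open Summit.BirchSwinnertonDyer.BirchSwinnertonDyer.Theorems.Rank1ResidualX1Defs
  Summit.BirchSwinnertonDyer.BirchSwinnertonDyer.Rank1Residual
open Summit.BirchSwinnertonDyer.Rank1Residual Summit.BirchSwinnertonDyer.Rank1Residual.X5
open Summit.BirchSwinnertonDyer.BirchSwinnertonDyer.Theorems.OrdKatoOptimalAtTwo
  Summit.BirchSwinnertonDyer.BirchSwinnertonDyer.Theorems.OrdKatoIntAtTwo
open Summit.BirchSwinnertonDyer.BirchSwinnertonDyer.Theses.ByReductionTypeAtTwo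

namespace Summit.BirchSwinnertonDyer.BirchSwinnertonDyer.Cruxes.OrdKatoHalfAtTwoIso.SignBlindKolyvaginPrimes

/-! ### §1 The local lever: `Frob_q − 1` on `E[2] ⊗ Ω_J` at a transposition prime of depth `s` -/

section LocalLever

variable {R : Type*} [CommRing R]

/-- `N = Frob_q − 1 = τ ⊗ γ_q − 1` on `E[2] ⊗_{𝔽₂} Ω_J ≅ R × R` in the basis (τ-fixed, τ-moved):
`N(x, y) = (s x + u y, s y)` where `γ_q = 1 + s` and `u = γ_q` (a unit). -/
def frobMinusOne (s u : R) : (R × R) →ₗ[R] (R × R) where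
  toFun v := (s * v.1 + u * v.2, s * v.2)
  map_add' v v' := by
    ext <;> simp only [Prod.fst_add, Prod.snd_add] <;> ring
  map_smul' c v := by
    ext <;> simp only [Prod.smul_fst, Prod.smul_snd, smul_eq_mul, RingHom.id_apply] <;> ring

@[simp] theorem frobMinusOne_apply (s u : R) (v : R × R) :
    frobMinusOne s u v = (s * v.1 + u * v.2, s * v.2) := rfl

/-- In characteristic `2` with `s² = 0` (i.e. `J ≤ 2·depth`): `N² = 0` — Cayley–Hamilton for
`P_q(x) ≡ (1 + x)² (mod 2)` (`a_q` even, `q ≡ 1 (mod 2)`). -/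
theorem frobMinusOne_comp_self (s u : R) (h2 : (2 : R) = 0) (hs : s * s = 0) :
    (frobMinusOne s u) ∘ₗ (frobMinusOne s u) = 0 := by
  refine LinearMap.ext fun v => ?_
  refine Prod.ext ?_ ?_ <;> simp only [LinearMap.comp_apply, frobMinusOne_apply, LinearMap.zero_apply,
    Prod.fst_zero, Prod.snd_zero]
  · have : s * (s * v.1 + u * v.2) + u * (s * v.2) = (s * s) * v.1 + 2 * (s * u * v.2) := by ring
    rw [this, hs, h2]; ring
  · have : s * (s * v.2) = (s * s) * v.2 := by ring
    rw [this, hs]; ring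

/-- **Rank-one Kolyvagin condition + `φ^{fs}` iso, characteristic 2.**  `ker N = range N`
(so `H¹_s(ℚ_q, 𝒯̄_J) = ker N ≅ (R×R)/ker N ≅ range N` and multiplication by `N` induces
`coker N = H¹_f ≅ H¹_s`).  Needs: `2 = 0`, `s² = 0`, `u` a unit. -/
theorem ker_frobMinusOne_eq_range (s u w : R) (h2 : (2 : R) = 0) (hs : s * s = 0) (huw : u * w = 1) :
    LinearMap.ker (frobMinusOne s u) = LinearMap.range (frobMinusOne s u) := by
  ext ⟨a, b⟩
  simp only [LinearMap.mem_ker, LinearMap.mem_range, frobMinusOne_apply, Prod.mk.injEq, Prod.exists,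
    Prod.mk_eq_zero]
  constructor
  · rintro ⟨h1, hb⟩
    refine ⟨0, w * a, ?_, ?_⟩
    · linear_combination a * huw
    · linear_combination w * h1 - b * huw - b * h2
  · rintro ⟨x, y, rfl, rfl⟩
    constructor
    · have : s * (s * x + u * y) + u * (s * y) = (s * s) * x + 2 * (s * u * y) := by ring
      rw [this, hs, h2]; ring
    · have : s * (s * y) = (s * s) * y := by ring
      rw [this, hs]; ring

/-- `range N = {(u y, s y)}`: the column of the τ-moved basis vector spans, so `range N` (hence
`H¹_s` and `H¹_f`) is CYCLIC, generated by one element — free of rank one over `Ω_J` since `u` is a unit. -/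
theorem mem_range_frobMinusOne_iff (s u w : R) (hs : s * s = 0) (huw : u * w = 1) (a b : R) :
    (a, b) ∈ LinearMap.range (frobMinusOne s u) ↔ ∃ y : R, a = u * y ∧ b = s * y := by
  simp only [LinearMap.mem_range, frobMinusOne_apply, Prod.mk.injEq, Prod.exists]
  constructor
  · rintro ⟨x, y, rfl, rfl⟩
    refine ⟨y + w * s * x, ?_, ?_⟩
    · linear_combination (-(s * x)) * huw
    · linear_combination (-(w * x)) * hs
  · rintro ⟨y, rfl, rfl⟩
    exact ⟨0, y, by ring, rfl⟩

/-- The generator map `y ↦ (u y, s y)` is injective (`u` a unit): `range N ≅ R`. -/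
theorem colGen_injective (s u w : R) (huw : u * w = 1) :
    Function.Injective (fun y : R => (u * y, s * y)) := by
  intro y y' h
  simp only [Prod.mk.injEq] at h
  linear_combination w * h.1 - (y - y') * huw

end LocalLever

/-! ### §2 Sign-blind depth: `q ≡ −1 (mod 2^{m+2})` is `Γ`-deep AND a transposition prime -/

/-- `q ≡ −1 (mod 2^{m+2})` forces `q ≡ 3 (mod 4)` (so `q` is inert in `ℚ(i) = ℚ(√Δ)`: `ρ̄(Frob_q)` is a
transposition on the DD12 residue), while `q² ≡ 1 (mod 2^{m+3})`, i.e. `Frob_q² ∈ Gal(ℚ(μ_{2^∞})/ℚ)`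
is `2^{m+1}`-deep and `Frob_q|_{ℚ_m} = 1` (`ℚ_m = ℚ(ζ_{2^{m+2}})⁺` is fixed by `−1`).  Decidable sanity
for `m < 6`. -/
example : ∀ m < 6, (2 ^ (m + 2) - 1) % 4 = 3 ∧ ((2 ^ (m + 2) - 1) ^ 2) % 2 ^ (m + 3) = 1 := by decide

/-- `m = 1`, `q = 7 ≡ −1 (mod 8)`: in `Ω_4 = 𝔽₂[T]/(T⁴)` with `γ_q = (1+T)² = 1 + T²`, `s = T²`,
`s² = T⁴ = 0` — the hypothesis `hs` of §1 at `J = 4 = 2^{m+1}`.  (Recorded as the arithmetic instance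
`7 % 8 = 7`, `7 % 4 = 3`; the `Ω_4` identity is `(T²)² = T⁴`.) -/
example : 7 % 8 = 8 - 1 ∧ 7 % 4 = 3 ∧ (7 ^ 2) % 16 = 1 := by decide

/-! ### §3 The typed output of the line (= L1's SOCKET 1, `p = 2` Euler-system spelling) -/

/-- **OUTPUT of the sign-blind line (OPEN; nothing asserted).**  For `W/ℚ` globally minimal, good
ordinary at `2`, `ρ̄_{E,2}` onto `GL₂(𝔽₂)`, `Δ < 0`, cyclotomic `(κ, γ)`, Kato's `𝐇¹_Γ(T₂W)` (`I`): if a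
GENUINE `2`-adic Λ-adic Euler-system class `s ∈ 𝐇¹` (tree `IsEulerSystemClassTwo`, the `p = 2` spelling)
is not divisible by `2`, then some iterate `(conj_γ − id)^[J]` kills every `y ∈ H¹(ℚ_∞, E[2])` landing in
`Sel₀(ℚ_∞, E[2^∞])` (⇔ `μ(X_fine) = 0`).  MECHANISM (this card): ONE transposition Kolyvagin prime
`q ≡ −1 (mod 2^{m+2})` over `Ω_J = 𝔽₂[T]/(T^J)` (§1), `τ` = complex conjugation; NOT the E-split rank-two
port of L1.  Same conclusion as `SteinbergFibreAtTwo.CoreTheoremATwoResidue` VERBATIM except the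
predicate `IsEulerSystemClassTwo W hκ I s` replaces `IsEulerSystemClass W 2 κ γ I s` (empty at `p = 2`).
[cite: Kato2004Asterisque, §13.1, Thm. 13.4 (pp. 224–226) (shape only; nothing asserted)]
[cite: MazurRubin2004, Def. 3.1.3, Lemma 1.2.3 (shape only)] -/
@[conjecture] def RankOneOmegaPortAtTwo : Prop :=
  ∀ (W : WeierstrassCurve ℚ) [W.IsElliptic] [W.IsGloballyMinimal]
    [ContinuousSMul ℤ_[2] (W.tateModule 2)] [Module.Free ℤ_[2] (W.tateModule 2)]
    [Module.Finite ℤ_[2] (W.tateModule 2)]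
    (κ : ZpExtension ℚ 2) (γ : absoluteGaloisGroup ℚ) (I : IwasawaH1Data W 2 κ γ)
    (hκ : κ.IsCyclotomic),
    W.HasGoodReductionAtPrime 2 → ¬ (2 : ℤ) ∣ W.frobeniusTrace 2 →
    W.HasSurjectiveModNGaloisRep 2 → W.Δ < 0 → κ.IsTopGenerator γ →
    (∃ s : I.H, IsEulerSystemClassTwo W hκ I s ∧
      s ∉ IwasawaAlgebra.augIdealP 2 • (⊤ : Submodule (IwasawaAlgebra 2) I.H)) →
    ∃ J : ℕ, ∀ y : Literature.NumberTheory.EllipticCurves.subgroupH1 κ.kerSubgroup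
        (WeierstrassCurve.geomTorsion W (2 : ℤ)),
      W.torsionToPrimaryH1Sub 2 κ.kerSubgroup y ∈ W.fineSelmerInfty κ →
        (⇑(Literature.NumberTheory.EllipticCurves.conjH1 κ.kerSubgroup
            (WeierstrassCurve.geomTorsion W (2 : ℤ)) γ -
          AddMonoidHom.id (Literature.NumberTheory.EllipticCurves.subgroupH1 κ.kerSubgroup
            (WeierstrassCurve.geomTorsion W (2 : ℤ)))))^[J] y = 0

end Summit.BirchSwinnertonDyer.BirchSwinnertonDyer.Cruxes.OrdKatoHalfAtTwoIso.SignBlindKolyvaginPrimes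

end
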